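import Summits.PneNP.PneNP.Theorems.OneSliceShallowSliceBoundForcingBad

/-!
# Route OneSlice, item `ShallowSliceBound` (stmt-PneNP-14083): forcing up (Leg A, assembly)

Helper file (prover seat, 2026-08-16), def-free. **Leg A** of the proof of `ShallowSliceBound`: `forcing_up` — for
`k ≥ 5`, `4c < k` and `η > 0` there are `θ, δ > 0` such that, eventually in `n`, for every central `j` and every
circuit `C` over `{∧₂, ∨₂, 0, 1}` with at most `n^c` gates that errs against `k`-CLIQUE on at most `δ · #slice_j`
graphs of the slice `j`, `a_t(C) ≥ 1 - η` for EVERY slice `t` with `j + j^{1-θ} ≤ t ≤ C(n,2)`. Ingredients: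
`card_badH_le` (`…ForcingBad.lean`), Rossman's Theorem 1 `thm1_finite` on the restriction `C^H`
(`Circuit.exists_restrict_sup`), the law of `H ⊔ G⁻` (`…Sprinkle.lean`), monotone slices (`…Slices.lean`), and
the window / tail bookkeeping (`…ForcingWindow.lean`). [cite: Rossman2010, Thm 1 (p. 4), §7 (p. 10)]
-/

set_option linter.dupNamespace false

noncomputable section

namespace Summit.PneNP.PneNP.Theorems.ShallowSliceBound

open Finset Filter Literature.Computability.Complexity Classical
open Summit.PneNP.PneNP.Theorems.ConstantBand.Negative (Edge thr Central slice errSet)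
open Summit.PneNP.PneNP.Cruxes.ConstantBand.FlatPriorRelativeMinterms (ts_mem_slice ts_card_slice_pos ts_mem_errSet)
open Summit.PneNP.PneNP.Cruxes.SliceACZero.RussoWindowLadder (wt sliceAvg)
open scoped Topology

variable {n : ℕ}

/-- **The mixture bound**: for a monotone `f`, `t ≤ C(n,2)` and nonnegative slice weights `κ_ℓ`,
`Σ_z [f z = 1 ∧ |z| ≤ t] κ_{|z|} ≤ a_t(f) · Σ_z κ_{|z|}` (the acceptance of each slice `ℓ ≤ t` is at most `a_t`).
[folklore] -/
theorem sum_ite_mul_le_sliceAvg_mul {f : (Edge n → Bool) → Bool} (hf : Monotone f) {t : ℕ} (ht : t ≤ n.choose 2)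
    (κ : ℕ → ℝ) (hκ : ∀ ℓ, 0 ≤ κ ℓ) :
    ∑ z : Edge n → Bool, (if f z = true ∧ edgeCount z ≤ t then (1 : ℝ) else 0) * κ (edgeCount z) ≤
      sliceAvg f t * ∑ z : Edge n → Bool, κ (edgeCount z) := by
  have hcard : Fintype.card (Edge n) = n.choose 2 := card_edgeSet_top_fin n
  have hmaps : ∀ z ∈ (univ : Finset (Edge n → Bool)), wt z ∈ range (n.choose 2 + 1) := by
    intro z _
    rw [mem_range, Nat.lt_succ_iff, ← hcard, wt, ← card_univ]
    exact card_filter_le _ _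
  rw [← sum_fiberwise_of_maps_to hmaps, ← sum_fiberwise_of_maps_to (g := fun z => wt z) hmaps, mul_sum]
  refine sum_le_sum fun ℓ _ => ?_
  have hpos : (0 : ℝ) < #(univ.filter fun x : Edge n → Bool => wt x = t) := by
    exact_mod_cast card_slice_pos (ι := Edge n) (by rw [hcard]; exact ht)
  by_cases hℓt : ℓ ≤ t
  · -- the fibre `ℓ ≤ t`: `κ_ℓ · acc_ℓ ≤ κ_ℓ · a_t · #slice_ℓ`
    have h1 : ∑ z ∈ univ.filter (fun z : Edge n → Bool => wt z = ℓ),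
        (if f z = true ∧ edgeCount z ≤ t then (1 : ℝ) else 0) * κ (edgeCount z) =
        κ ℓ * #(univ.filter fun z : Edge n → Bool => wt z = ℓ ∧ f z = true) := by
      rw [card_eq_sum_ones, Nat.cast_sum, mul_sum, sum_filter, sum_filter]
      refine sum_congr rfl fun z _ => ?_
      by_cases hz : wt z = ℓ
      · have hez : edgeCount z = ℓ := hz
        simp only [hz, hez, hℓt, and_true, true_and, ↓reduceIte, Nat.cast_one, mul_one]
        by_cases hfz : f z = true <;> simp [hfz]
      · simp [hz]
    have h2 : ∑ z ∈ univ.filter (fun z : Edge n → Bool => wt z = ℓ), κ (edgeCount z) =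
        κ ℓ * #(univ.filter fun z : Edge n → Bool => wt z = ℓ) := by
      rw [card_eq_sum_ones, Nat.cast_sum, mul_sum]
      refine sum_congr rfl fun z hz => ?_
      rw [mem_filter] at hz
      have hez : edgeCount z = ℓ := hz.2
      rw [hez]; simp
    rw [h1, h2, sliceAvg]
    have hmono := card_acc_mul_le hf hℓt (by rw [hcard]; exact ht)
    rw [div_mul_eq_mul_div, le_div_iff₀ hpos]
    calc κ ℓ * #(univ.filter fun z : Edge n → Bool => wt z = ℓ ∧ f z = true) *
          #(univ.filter fun x : Edge n → Bool => wt x = t)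
        = κ ℓ * ((#(univ.filter fun z : Edge n → Bool => wt z = ℓ ∧ f z = true) : ℝ) *
            #(univ.filter fun x : Edge n → Bool => wt x = t)) := by ring
      _ ≤ κ ℓ * ((#(univ.filter fun x : Edge n → Bool => wt x = t ∧ f x = true) : ℝ) *
            #(univ.filter fun x : Edge n → Bool => wt x = ℓ)) := mul_le_mul_of_nonneg_left hmono (hκ ℓ)
      _ = _ := by ring
  · -- the fibre `ℓ > t` contributes nothing
    have h1 : ∑ z ∈ univ.filter (fun z : Edge n → Bool => wt z = ℓ),
        (if f z = true ∧ edgeCount z ≤ t then (1 : ℝ) else 0) * κ (edgeCount z) = 0 := by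
      refine sum_eq_zero fun z hz => ?_
      rw [mem_filter] at hz
      have hez : edgeCount z = ℓ := hz.2
      rw [if_neg, zero_mul]
      rw [hez]; exact fun h => hℓt h.2
    rw [h1]
    exact mul_nonneg (sliceAvg_nonneg f t) (sum_nonneg fun z _ => hκ _)

/-- **Leg A: forcing up.** For `k ≥ 5`, `4c < k` and `η > 0` there are `θ, δ > 0` such that, eventually in `n`, for
every central `j`, every circuit `C` over `{∧₂, ∨₂, 0, 1}` with `≤ n^c` gates and `#err_j(C, CLIQUE_k) ≤ δ #slice_j`
has slice acceptance `a_t(C) ≥ 1 - η` for all `t` with `j + j^{1-θ} ≤ t ≤ C(n,2)`. (Registered sub-goal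
`forcing_up` of stmt-PneNP-14083.) [cite: Rossman2010, Thm 1 (p. 4), §7 (p. 10)] -/
theorem forcing_up :
    ∀ k : ℕ, 5 ≤ k → ∀ c : ℕ, 4 * c < k → ∀ η : ℝ, 0 < η →
      ∃ θ : ℝ, 0 < θ ∧ ∃ δ : ℝ, 0 < δ ∧ ∀ᶠ n : ℕ in atTop, ∀ j : ℕ, Central k n j →
        ∀ C : Circuit (Edge n), C.IsOver monotoneBasis01 → C.size ≤ n ^ c →
          (#(errSet n k j C) : ℝ) ≤ δ * #(slice n j) →
          ∀ t : ℕ, (j : ℝ) + (j : ℝ) ^ (1 - θ) ≤ t → t ≤ n.choose 2 → 1 - η ≤ sliceAvg C.eval t := by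
  intro k hk c hc η hη
  have hk2 : 2 ≤ k := by omega
  have hkR : (5 : ℝ) ≤ k := by exact_mod_cast hk
  -- constants
  obtain ⟨δ₁, hδ₁⟩ : ∃ d : ℝ, d = 1 / (k : ℝ) ^ 3 := ⟨_, rfl⟩
  have hδ₁0 : 0 < δ₁ := by rw [hδ₁]; positivity
  have hδ₁1 : δ₁ ≤ 1 / (k : ℝ) ^ 3 := hδ₁.le
  obtain ⟨θ, hθ⟩ : ∃ th : ℝ, th = δ₁ / (2 * ((k : ℝ) - 1)) := ⟨_, rfl⟩
  have hθ0 : 0 < θ := by rw [hθ]; exact div_pos hδ₁0 (by linarith)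
  have hθ1 : θ ≤ 1 := by
    rw [hθ, div_le_one (by linarith), hδ₁]
    have : (1 : ℝ) / (k : ℝ) ^ 3 ≤ 1 := by
      rw [div_le_one (by positivity)]; exact one_le_pow₀ (by linarith)
    linarith
  set K := k.choose 2 with hK
  obtain ⟨B, hB⟩ : ∃ b : ℝ, b = (1 + k * 2 ^ k * (2 : ℝ) ^ K) * ((2 : ℝ) ^ K * 2 ^ k * k.factorial * 8 ^ K) :=
    ⟨_, rfl⟩
  have hB0 : 0 < B := by rw [hB]; positivity
  obtain ⟨δ, hδ⟩ : ∃ d : ℝ, d = (η / 8) ^ 2 / B := ⟨_, rfl⟩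
  have hδ0 : 0 < δ := by rw [hδ]; positivity
  have hsqrt : 2 * Real.sqrt (δ * B) = η / 4 := by
    rw [hδ, div_mul_cancel₀ _ hB0.ne', Real.sqrt_sq (by positivity)]; ring
  refine ⟨θ, hθ0, δ, hδ0, ?_⟩
  -- the largeness conditions
  have hr : Tendsto (fun n : ℕ => (n : ℝ) ^ (-(2 : ℝ) / ((k : ℝ) - 1))) atTop (𝓝 0) :=
    tendsto_rpow_threshold (k := k) hk2
  have E3 : ∀ᶠ n : ℕ in atTop, (K : ℝ) * (n : ℝ) ^ (-(2 : ℝ) / ((k : ℝ) - 1)) ≤ η / 16 := by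
    have h := hr.const_mul (K : ℝ)
    rw [mul_zero] at h
    exact h.eventually (eventually_le_nhds (by positivity))
  have hcp := cPrime_pos hk hδ₁0 hδ₁1
  have E6 : ∀ᶠ n : ℕ in atTop, ((n ^ c + 1 : ℕ) : ℝ) ≤ 2 * (n : ℝ) ^ ((k : ℝ) / 4) := by
    filter_upwards [eventually_ge_atTop 1] with n hn
    have hn1 : (1 : ℝ) ≤ n := by exact_mod_cast hn
    have hck : (c : ℝ) ≤ (k : ℝ) / 4 := by
      have : ((4 * c : ℕ) : ℝ) < k := by exact_mod_cast hc
      push_cast at this; linarith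
    have h1 : (n : ℝ) ^ (c : ℝ) ≤ (n : ℝ) ^ ((k : ℝ) / 4) := Real.rpow_le_rpow_of_exponent_le hn1 hck
    rw [Real.rpow_natCast] at h1
    have h2 : (1 : ℝ) ≤ (n : ℝ) ^ ((k : ℝ) / 4) := Real.one_le_rpow hn1 (by positivity)
    push_cast; linarith
  filter_upwards [eventually_largeN hk hδ₁0 hδ₁1 2 (1 / 2) (by norm_num), forcing_window (k := k) (by omega), E3,
    eventually_exp_neg_rpow_le hcp (by positivity : (0 : ℝ) < η / 4),
    forcing_tail_eventually hk2 hδ₁0 (by positivity : (0 : ℝ) < η / 4), E6, eventually_ge_atTop 1]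
    with n hL hW hE3 hE4 hE5 hE6 hn1 j hj C hC hsize herr t hjt htN
  -- trivial when `η ≥ 1`
  rcases le_or_gt 1 η with hη1 | hη1
  · exact le_trans (by linarith) (sliceAvg_nonneg _ _)
  obtain ⟨hNpos, hkn, hWj⟩ := hW
  obtain ⟨hjK2, h4j, hjT, hTj⟩ := hWj j hj
  set N := n.choose 2 with hN
  set r : ℝ := (n : ℝ) ^ (-(2 : ℝ) / ((k : ℝ) - 1)) with hrdef
  obtain ⟨j', hj'⟩ : ∃ j' : ℕ, j = j' + K := ⟨j - K, by omega⟩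
  have hKj' : K ≤ j' := by omega
  have hjN : j ≤ N := by omega
  have hj'N : j' ≤ N := by omega
  have hNr : (0 : ℝ) < N := by exact_mod_cast hNpos
  have hnR : (1 : ℝ) ≤ n := by exact_mod_cast hn1
  have hn0 : (0 : ℝ) < n := by linarith
  have hr0 : 0 < r := Real.rpow_pos_of_pos hn0 _
  have hjR : (j : ℝ) = j' + K := by rw [hj']; push_cast; ring
  have hj'R : (K : ℝ) ≤ j' := by exact_mod_cast hKj'
  have hK1 : (1 : ℝ) ≤ K := by
    have : 1 ≤ K := by rw [hK]; exact Nat.choose_pos hk2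
    exact_mod_cast this
  have hjpos : (0 : ℝ) < j := by rw [hjR]; linarith
  set S' := slice n j' with hS'
  have hS'pos : (0 : ℝ) < #S' := by exact_mod_cast ts_card_slice_pos hj'N
  set p : ℝ := pMinus k δ₁ n with hpdef
  have hp0 : 0 < p := Real.rpow_pos_of_pos hn0 _
  have hp1 : p ≤ 1 := by have := hL.hp; linarith
  -- Step A: few bad `H`
  have hbadH : (#(S'.filter fun H => 2 * #((powersetCard k (univ : Finset (Fin n))).filter
      fun A => C.eval (H ⊔ cliqueVec A) = true) < n.choose k) : ℝ) ≤ η / 2 * #S' := by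
    have hjb : ((j' + k.choose 2 : ℕ) : ℝ) / (n.choose 2 : ℕ) ≤ 2 * (n : ℝ) ^ (-(2 : ℝ) / ((k : ℝ) - 1)) := by
      rw [← hK, ← hj', ← hN, div_le_iff₀ hNr]; linarith
    have hja : (1 / 8 : ℝ) * (n : ℝ) ^ (-(2 : ℝ) / ((k : ℝ) - 1)) ≤ (j' : ℝ) / (n.choose 2 : ℕ) := by
      rw [← hN, le_div_iff₀ hNr]
      have : ((j : ℝ) - (k.choose 2 : ℕ)) = j' := by rw [hjR, hK]; ring
      rw [this] at hTj
      rw [← hrdef]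
      linarith
    have herr' : (#(errSet n k (j' + k.choose 2) C) : ℝ) ≤ δ * #(slice n (j' + k.choose 2)) := by
      rw [← hK, ← hj']; exact herr
    have h := card_badH_le hk2 hkn (by rw [← hK]; exact hKj') (by rw [← hK, ← hj']; exact hjN) hjb hja C hδ0.le herr'
    rw [← hK, ← hB, hsqrt, ← hS'] at h
    refine h.trans (mul_le_mul_of_nonneg_right ?_ hS'pos.le)
    -- `2 K j'/N ≤ 4 K r ≤ η/4`
    have h1 : (2 * K * j' : ℝ) / (n.choose 2 : ℕ) ≤ 4 * ((K : ℝ) * r) := by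
      rw [← hN, div_le_iff₀ hNr]
      have hj'j : (j' : ℝ) ≤ j := by rw [hjR]; linarith
      have : (j' : ℝ) ≤ 2 * (N * r) := hj'j.trans hjT
      have hK0 : (0 : ℝ) ≤ K := Nat.cast_nonneg _
      nlinarith only [this, hK0]
    linarith
  -- Step B: good `H` accept most of `G(n,p⁻)` shifted by `H` (Theorem 1)
  have hgood : ∀ H ∈ S', ¬ (2 * #((powersetCard k (univ : Finset (Fin n))).filter
      fun A => C.eval (H ⊔ cliqueVec A) = true) < n.choose k) →
      1 - Real.exp (-((n : ℝ) ^ cPrime k δ₁)) ≤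
        ∑ y : Edge n → Bool, gnpWeight n p y * (if C.eval (H ⊔ y) = true then (1 : ℝ) else 0) := by
    intro H _ hgoodH
    obtain ⟨C', hC'B, hC's, hC'e⟩ := C.exists_restrict_sup hC H
    have hsizeR : (C'.size : ℝ) ≤ 2 * (n : ℝ) ^ ((k : ℝ) / 4) := by
      have : C'.size ≤ n ^ c + 1 := hC's.trans (by omega)
      have : (C'.size : ℝ) ≤ ((n ^ c + 1 : ℕ) : ℝ) := by exact_mod_cast this
      exact this.trans hE6
    have hCnk : 0 < n.choose k := Nat.choose_pos (by omega)
    have hacc : (1 / 2 : ℝ) ≤ kSubsetProb n k (fun A => C'.eval (cliqueVec A) = true) := by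
      rw [kSubsetProb, le_div_iff₀ (by exact_mod_cast hCnk)]
      push Not at hgoodH
      have : (powersetCard k (univ : Finset (Fin n))).filter (fun A => C'.eval (cliqueVec A) = true) =
          (powersetCard k (univ : Finset (Fin n))).filter (fun A => C.eval (H ⊔ cliqueVec A) = true) := by
        refine filter_congr fun A _ => ?_; rw [hC'e]
      rw [this]
      have : ((n.choose k : ℕ) : ℝ) ≤ 2 * #((powersetCard k (univ : Finset (Fin n))).filter
          fun A => C.eval (H ⊔ cliqueVec A) = true) := by exact_mod_cast hgoodH
      linarith
    have h1 := thm1_finite hk hδ₁0 hδ₁1 (by norm_num : (0 : ℝ) < 1 / 2) hL C' hC'B hsizeR hacc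
    rw [← hpdef, gnpProb_filter] at h1
    refine h1.trans (le_of_eq (sum_congr rfl fun y _ => ?_))
    rw [hC'e]
    by_cases hy : C.eval (H ⊔ y) = true <;> simp [hy]
  -- Step C: the total over `H`, lower bound
  set e : ℝ := Real.exp (-((n : ℝ) ^ cPrime k δ₁)) with hedef
  have he1 : e ≤ 1 := by rw [hedef]; exact Real.exp_le_one_iff.2 (by have := Real.rpow_nonneg hn0.le (cPrime k δ₁); linarith)
  have hlow : ((#S' : ℝ) - η / 2 * #S') * (1 - e) ≤
      ∑ H ∈ S', ∑ y : Edge n → Bool, gnpWeight n p y * (if C.eval (H ⊔ y) = true then (1 : ℝ) else 0) := by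
    set badH := S'.filter fun H => 2 * #((powersetCard k (univ : Finset (Fin n))).filter
      fun A => C.eval (H ⊔ cliqueVec A) = true) < n.choose k with hbadHdef
    have hnn : ∀ H ∈ S', 0 ≤ ∑ y : Edge n → Bool, gnpWeight n p y * (if C.eval (H ⊔ y) = true then (1 : ℝ) else 0) :=
      fun H _ => sum_nonneg fun y _ => mul_nonneg (gnpWeight_nonneg hp0.le hp1 y) (by positivity)
    calc ((#S' : ℝ) - η / 2 * #S') * (1 - e) ≤ ((#S' : ℝ) - #badH) * (1 - e) :=
          mul_le_mul_of_nonneg_right (by linarith) (by linarith)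
      _ = #(S' \ badH) * (1 - e) := by
          rw [card_sdiff_of_subset (filter_subset _ _), Nat.cast_sub (card_le_card (filter_subset _ _))]
      _ = ∑ H ∈ S' \ badH, (1 - e) := by rw [sum_const, nsmul_eq_mul]
      _ ≤ ∑ H ∈ S' \ badH, ∑ y : Edge n → Bool, gnpWeight n p y * (if C.eval (H ⊔ y) = true then (1 : ℝ) else 0) := by
          refine sum_le_sum fun H hH => ?_
          obtain ⟨hH1, hH2⟩ := mem_sdiff.1 hH
          exact hgood H hH1 fun hb => hH2 (mem_filter.2 ⟨hH1, hb⟩)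
      _ ≤ _ := sum_le_sum_of_subset_of_nonneg sdiff_subset fun H hH _ => hnn H hH
  -- Step D: the total over `H`, upper bound
  have hmono : Monotone C.eval := C.monotone_eval_of_isOver_monotoneBasis01 hC
  have hjt' : j' ≤ t := by
    have : (j : ℝ) ≤ t := by have := Real.rpow_nonneg hjpos.le (1 - θ); linarith
    have : j ≤ t := by exact_mod_cast this
    omega
  have hup : ∑ H ∈ S', ∑ y : Edge n → Bool, gnpWeight n p y * (if C.eval (H ⊔ y) = true then (1 : ℝ) else 0) ≤
      sliceAvg C.eval t * #S' + #S' * (N * p) / ((t : ℝ) + 1 - j') := by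
    -- split the indicator at `|H ⊔ y| ≤ t`
    have hsplit : ∀ H : Edge n → Bool, ∀ y : Edge n → Bool,
        gnpWeight n p y * (if C.eval (H ⊔ y) = true then (1 : ℝ) else 0) =
        gnpWeight n p y * (if C.eval (H ⊔ y) = true ∧ edgeCount (H ⊔ y) ≤ t then (1 : ℝ) else 0) +
        gnpWeight n p y * (if C.eval (H ⊔ y) = true ∧ t < edgeCount (H ⊔ y) then (1 : ℝ) else 0) := by
      intro H y
      rw [← mul_add]
      congr 1
      by_cases h1 : C.eval (H ⊔ y) = true
      · by_cases h2 : edgeCount (H ⊔ y) ≤ t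
        · simp [h1, h2]
        · simp [h1, h2, not_le.1 h2]
      · simp [h1]
    simp_rw [hsplit, sum_add_distrib]
    refine add_le_add ?_ ?_
    · -- the main part: a mixture of slices `≤ t`
      have hlaw := sum_slice_sum_gnpWeight_sup p j'
        (fun z => if C.eval z = true ∧ edgeCount z ≤ t then (1 : ℝ) else 0) (n := n)
      rw [← hS'] at hlaw
      rw [hlaw]
      have hmix := sum_ite_mul_le_sliceAvg_mul hmono htN
        (fun ℓ => (ℓ.choose j' : ℝ) * p ^ (ℓ - j') * (1 - p) ^ (n.choose 2 - ℓ))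
        (fun ℓ => by have := hp0.le; have : 0 ≤ 1 - p := by linarith
                     positivity)
      refine hmix.trans (le_of_eq ?_)
      rw [sum_choose_mul_pow_eq_card_slice p j', ← hS']
    · -- the tail: Markov
      have htail := sum_slice_gnpWeight_edgeCount_sup_gt_le hp0.le hp1 hjt' (n := n)
      rw [← hS', ← hN] at htail
      have hden : (0 : ℝ) < (t : ℝ) + 1 - j' := by
        have : (j' : ℝ) ≤ t := by exact_mod_cast hjt'
        linarith
      rw [le_div_iff₀ hden, mul_comm]
      refine le_trans ?_ htail
      refine mul_le_mul_of_nonneg_left (sum_le_sum fun H _ => ?_) hden.le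
      rw [sum_filter]
      refine sum_le_sum fun y _ => ?_
      by_cases h : t < edgeCount (H ⊔ y)
      · rw [if_pos h]
        have := gnpWeight_nonneg hp0.le hp1 y
        by_cases h' : C.eval (H ⊔ y) = true <;> simp [h', h, this]
      · rw [if_neg h]
        simp [h]
  -- Step E: the tail is small
  have htail : (N : ℝ) * p / ((t : ℝ) + 1 - j') ≤ η / 4 := by
    have hden : (j : ℝ) ^ (1 - θ) ≤ (t : ℝ) + 1 - j' := by rw [hjR] at hjt ⊢; linarith
    have hden0 : (0 : ℝ) < (j : ℝ) ^ (1 - θ) := Real.rpow_pos_of_pos hjpos _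
    -- `N p = (N r) n^{-2δ₁/(k-1)} ≤ 8 j n^{-2δ₁/(k-1)}`
    have hNp : (N : ℝ) * p ≤ 8 * j * (n : ℝ) ^ (-(2 * δ₁) / ((k : ℝ) - 1)) := by
      have hsplit : p = r * (n : ℝ) ^ (-(2 * δ₁) / ((k : ℝ) - 1)) := by
        rw [hpdef, pMinus, hrdef, ← Real.rpow_add hn0]; congr 1; ring
      rw [hsplit, ← mul_assoc]
      refine mul_le_mul_of_nonneg_right ?_ (Real.rpow_nonneg hn0.le _)
      have : (j : ℝ) - K ≤ j := by linarith [(Nat.cast_nonneg K : (0 : ℝ) ≤ K)]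
      have hK' : ((k.choose 2 : ℕ) : ℝ) = K := by rw [hK]
      rw [hK'] at hTj
      linarith
    -- `j ≤ n²`
    have hjn2 : (j : ℝ) ≤ (n : ℝ) ^ (2 : ℝ) := by
      have h1 : j ≤ n ^ 2 := hjN.trans (by rw [hN]; exact Nat.choose_le_pow n 2)
      have : (j : ℝ) ≤ ((n ^ 2 : ℕ) : ℝ) := by exact_mod_cast h1
      rw [Real.rpow_two]; push_cast at this; exact this
    calc (N : ℝ) * p / ((t : ℝ) + 1 - j') ≤ (8 * j * (n : ℝ) ^ (-(2 * δ₁) / ((k : ℝ) - 1))) / (j : ℝ) ^ (1 - θ) :=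
          div_le_div₀ (by positivity) hNp hden0 hden
      _ = 8 * ((j : ℝ) / (j : ℝ) ^ (1 - θ)) * (n : ℝ) ^ (-(2 * δ₁) / ((k : ℝ) - 1)) := by ring
      _ = 8 * (j : ℝ) ^ θ * (n : ℝ) ^ (-(2 * δ₁) / ((k : ℝ) - 1)) := by
          congr 2
          rw [div_eq_iff hden0.ne', ← Real.rpow_add hjpos]
          simp
      _ ≤ 8 * ((n : ℝ) ^ (2 : ℝ)) ^ θ * (n : ℝ) ^ (-(2 * δ₁) / ((k : ℝ) - 1)) := by
          gcongr
      _ ≤ η / 4 := by rw [hθ] ; exact hE5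
  -- Step F: combine
  have hcomb := hlow.trans hup
  have hfin : (1 - η / 2) * (1 - e) ≤ sliceAvg C.eval t + η / 4 := by
    have h1 : ((#S' : ℝ) - η / 2 * #S') * (1 - e) = #S' * ((1 - η / 2) * (1 - e)) := by ring
    have h2 : sliceAvg C.eval t * #S' + #S' * (N * p) / ((t : ℝ) + 1 - j') =
        #S' * (sliceAvg C.eval t + (N : ℝ) * p / ((t : ℝ) + 1 - j')) := by ring
    rw [h1, h2] at hcomb
    have h3 := le_of_mul_le_mul_left hcomb hS'pos
    linarith
  have he4 : e ≤ η / 4 := hE4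
  have h1 : (1 - η / 2) * (1 - η / 4) ≤ (1 - η / 2) * (1 - e) :=
    mul_le_mul_of_nonneg_left (by linarith only [he4]) (by linarith only [hη1])
  have h2 : (1 - η / 2) * (1 - η / 4) = 1 - 3 * η / 4 + η ^ 2 / 8 := by ring
  have h3 : (0 : ℝ) ≤ η ^ 2 / 8 := by positivity
  linarith only [hfin, h1, h2, h3]

end Summit.PneNP.PneNP.Theorems.ShallowSliceBound

end
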